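import Literature.Computability.Complexity.SearchToDecision
import Literature.Computability.Complexity.AdaptivePrograms
import HarnessLib

/-!
# Search with an `NP` oracle: every `P`-relation has a witness finder in `FP^{NP}`
# (Arora–Barak 2009, proof of Thm. 2.18, relativised; §3.4)

Topic `Computability/Complexity`, the oracle companion of `SearchToDecision.lean`. There the
bit-by-bit self-reduction of Arora–Barak's Theorem 2.18 (and of the guideline to Goldreich 2001,
§2.7.4, Exercise 2) is run UNDER `NP ⊆ P`: the extension language
`SuffExt R p = {⟨x, w⟩ | ∃ v, |v ++ w| ≤ p(|x|) ∧ ⟨x, v ++ w⟩ ∈ R}` of a relation `R ∈ P` is in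
`NP` (`SuffExt_mem_NP`), hence in `P`, and the search function `searchFn R p` (grow a suffix one
symbol per round, `p(|x|)` clocked rounds) is then in `FP` (`searchFn_mem_FP`) and returns a
bounded solution whenever one exists (`searchFn_spec`). The same program, with the membership test
in `SuffExt R p` answered by an ORACLE instead of a polynomial-time decider, is the textbook fact
that search reduces to decision relative to `NP` unconditionally: **for every `R ∈ P` and
polynomial `p` there are `L ∈ NP` and `g ∈ FP^L` with `|g x| ≤ p(|x|)` and `⟨x, g x⟩ ∈ R` for every
`x` that has some `y`, `|y| ≤ p(|x|)`, `⟨x, y⟩ ∈ R`** (`exists_searchFn_FPRel_NP`; here `L` is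
`SuffExt R p` itself and `g = searchFn R p`, `searchFn_mem_FPRel`).

Nothing is re-proved about the search: its correctness (`iterate_roundFn_spec`, `searchFn_spec`)
is a statement about the pure function `searchFn R p`, independent of how the two decision bits
of a round are obtained. Only the complexity bound is new, and it is assembled in the relativised
brick algebra `AdQuery.AdPres` of `AdaptivePrograms.lean` (`of_mem_FP`, `query`, `fanout`,
`FP_comp`/`comp_FP`, and the clocked loop `AdPres.iterate`, the analogue of `iterate_mem_FP` with
the same additive growth hypothesis `|roundFn z| ≤ |z| + 7`, `length_roundFn_le`), ending in
`AdPres.mem_FPRel` (`adFn_mem_FPRel`: adaptive oracle transducers compute `FP^A` functions).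

First consumer (val-lit, row X5): the `FP^{NP}` construction step in the proof of Kumar–Volk's
Cor. 1.3 (`Literature.Computability.AlgebraicComplexity.kumarVolk2020_cor_1_3`, ACM TOCT 14 (2022)
§6: "a family of matrices, constructible in polynomial time with an `NP` oracle" — prefix search
for a small circuit that is an equation, the relation being in `P` under `PIT ∈ P`).

## Main statements

* `bitsFn_adPres`, `roundFn_adPres`, `searchFn_adPres` — the round and the search function are
  adaptive `FP` programs over the oracle `SuffExt R p`, for `R ∈ P`;
* `searchFn_mem_FPRel` — `searchFn R p ∈ FP^{SuffExt R p}`;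
* `exists_searchFn_FPRel_NP` — search reduces to decision relative to an `NP` oracle;
* `exists_certificateFn_FPRel_NP` — the same for the certificates of a verifier
  (`IsPolyVerifierFor R p L`, Arora–Barak's Def. 2.1).

## References

* S. Arora, B. Barak, *Computational Complexity: A Modern Approach*, CUP 2009, §2.5, Thm. 2.18
  (decision versus search) and its proof; §3.4 (oracle machines; `FP` with an oracle).
* O. Goldreich, *Foundations of Cryptography I: Basic Tools*, CUP 2001, §2.7.4, Exercise 2
  (guideline: the `NP`-set of extendable partial solutions).
* R. E. Ladner, N. A. Lynch, A. L. Selman, *A comparison of polynomial time reducibilities*,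
  Theoret. Comput. Sci. 1 (1975) 103–123, §2 (adaptive queries).
-/

noncomputable section

namespace Literature.Computability.Complexity

open _root_.Computability StrCopy AdQuery

section Search

variable (R : Language Bool) (p : Polynomial ℕ)

/-- **The two decision bits of a round are an adaptive program over `SuffExt R p`**: the first bit
`[z ∈ R]` is polynomial time (`indicatorFn_mem_FP`), the second bit `[⟨x, 0w⟩ ∈ SuffExt R p]` is
ONE oracle query on the `FP`-image `mapSndFn (List.cons 0) z` (`AdPres.query`); fan-out and the
concatenation `appendFn` are `AdPres.fanout`, `AdPres.FP_comp`.
[cite: AroraBarak2009, Thm. 2.18 (proof) with §3.4] -/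
theorem bitsFn_adPres (hR : R ∈ Classes.P) : AdPres (SuffExt R p) (bitsFn R p) := by
  have h1 : AdPres (SuffExt R p) (fun z => encodeBool (R.boolIndicator z)) :=
    AdPres.of_mem_FP (indicatorFn_mem_FP hR)
  have h2 : AdPres (SuffExt R p)
      ((fun z => encodeBool ((SuffExt R p).boolIndicator z)) ∘ mapSndFn (List.cons false)) :=
    AdPres.query (A := SuffExt R p) (mapSndFn_mem_FP (cons_mem_FP false))
  unfold bitsFn
  exact AdPres.FP_comp (AdPres.fanout h1 h2) appendFn_mem_FP

/-- **The round function is an adaptive program over `SuffExt R p`** (`roundT ∘ ⟨bitsFn, id⟩`).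
[cite: AroraBarak2009, Thm. 2.18 (proof) with §3.4] -/
theorem roundFn_adPres (hR : R ∈ Classes.P) : AdPres (SuffExt R p) (roundFn R p) := by
  unfold roundFn
  exact AdPres.FP_comp (AdPres.fanout (bitsFn_adPres R p hR) AdPres.id)
    SearchDec.roundT.polyTimeComputable_eval

/-- **The search function is an adaptive program over `SuffExt R p`**: lay out `⟨x, ε⟩`
(`rePair ∘ dup`), run `p(|x|)` clocked rounds of the presented round function of additive growth
`7` (`AdPres.iterate`, `length_roundFn_le`), project to the second component.
[cite: AroraBarak2009, Thm. 2.18 (proof) with §3.4] -/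
theorem searchFn_adPres (hR : R ∈ Classes.P) : AdPres (SuffExt R p) (searchFn R p) := by
  have hin : (fun x : List Bool => boolPair x []) ∈ FP := by
    have : (fun x : List Bool => boolPair x []) = rePair ∘ dup := funext fun x => (rePair_dup x).symm
    rw [this]
    exact comp_mem_FP rePair_mem_FP dup_mem_FP
  have hit : AdPres (SuffExt R p)
      (fun z => (roundFn R p)^[p.eval (boolUnpair z).1.length] z) :=
    AdPres.iterate (roundFn_adPres R p hR) 7 (length_roundFn_le R p) p
  unfold searchFn
  exact AdPres.FP_comp (AdPres.comp_FP hit hin) boolUnpairSnd_mem_FP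

/-- **`searchFn R p ∈ FP^{SuffExt R p}`** for `R ∈ P` (`AdPres.mem_FPRel`, i.e. `adFn_mem_FPRel`).
[cite: AroraBarak2009, Thm. 2.18 (proof) with §3.4] -/
theorem searchFn_mem_FPRel (hR : R ∈ Classes.P) :
    searchFn R p ∈ FPRel (Oracle.ofLanguage (SuffExt R p)) :=
  (searchFn_adPres R p hR).mem_FPRel

end Search

/-! ### Search reduces to decision relative to `NP` -/

/-- **Search reduces to decision relative to an `NP` oracle.** For every relation `R ∈ P` (a
language of pairs `⟨x, y⟩`) and every polynomial `p` there are a language `L ∈ NP` and a function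
`g ∈ FP^L` such that, for every `x` admitting some `y` with `|y| ≤ p(|x|)` and `⟨x, y⟩ ∈ R`, `g x`
is such a `y` (`L = SuffExt R p`, `g = searchFn R p`). This is the proof of Arora–Barak's Thm. 2.18
read with the `NP`-language queried as an oracle rather than decided under `P = NP`.
[cite: AroraBarak2009, Thm. 2.18 (proof) with §3.4] -/
theorem exists_searchFn_FPRel_NP {R : Language Bool} (hR : R ∈ Classes.P) (p : Polynomial ℕ) :
    ∃ L ∈ Nondeterministic.NP, ∃ g ∈ FPRel (Oracle.ofLanguage L), ∀ x : List Bool,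
      (∃ y : List Bool, y.length ≤ p.eval x.length ∧ boolPair x y ∈ R) →
        (g x).length ≤ p.eval x.length ∧ boolPair x (g x) ∈ R :=
  ⟨SuffExt R p, SuffExt_mem_NP R p hR, searchFn R p, searchFn_mem_FPRel R p hR, searchFn_spec R p⟩

/-- **Certificates of an `NP` verifier can be found in `FP^{NP}`**: for a verifier relation
`R ∈ P` with witness bound `p` for `L` (`IsPolyVerifierFor R p L`), some `g ∈ FP^A`, `A ∈ NP`,
outputs on every `x ∈ L` a certificate of length `≤ p(|x|)`.
[cite: AroraBarak2009, Thm. 2.18 (proof) with §3.4] -/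
theorem exists_certificateFn_FPRel_NP {L R : Language Bool} {p : Polynomial ℕ}
    (hR : R ∈ Classes.P) (hV : IsPolyVerifierFor R p L) :
    ∃ A ∈ Nondeterministic.NP, ∃ g ∈ FPRel (Oracle.ofLanguage A),
      ∀ x ∈ L, (g x).length ≤ p.eval x.length ∧ boolPair x (g x) ∈ R := by
  obtain ⟨A, hA, g, hg, hspec⟩ := exists_searchFn_FPRel_NP hR p
  exact ⟨A, hA, g, hg, fun x hx => hspec x ((hV x).1 hx)⟩

end Literature.Computability.Complexity
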